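import Literature.Topology.FourManifolds.KirbyMovesSlideEndStepAData
import Literature.Topology.FourManifolds.KirbyMovesSlideEndRotation
import Literature.Topology.FourManifolds.KirbyMovesSlideEndFibreRotation
import Literature.Topology.FourManifolds.TubeIsotopyPushforward
import HarnessLib

/-!
# Normalising the band end, step A: the rotation isotopy and its effect on the band

Topic `Literature/Topology/FourManifolds`; fact seat `provefact-IsStrictHandleSlide.isSurgery`
(R. C. Kirby, *The Topology of 4-Manifolds*, LNM 1374 (1989), Ch. I §4; remaining content: the
named fact (S) `Literature.Topology.FourManifolds.FramedLink.IsStrictHandleSlide.slideModel`).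
Step A of the normalisation of the end of the slide band at the push-off `Kⱼ' = ν (·, e₀)`: the
ambient isotopy `H` of `S³` which rotates the tube `ν` about the circle `C₀ = S¹ × {e₀}` by the
angle of `KirbyMovesSlideEndStepAData.lean`, pushed forward along `ν`
(`TubeNbhd.tubeIsotopyPush`). Proved here (no definitions, no named facts):

* `Literature.Topology.FourManifolds.BandCore.exists_stepA` — for heights
  `1/10 < h₁ ≤ h₂ < 9/10` and `τ > 0` there is an ambient isotopy `H` of `S³` with: `H t` is the
  identity off `ν`'s image, on `ν (x, w)` whenever `‖w - e₀‖ ≥ τ`, and on `ν (x, w)` whenever `x`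
  is not over the open right-edge window; for `t ∈ [0, 1]`, `H t` fixes the push-off `Kⱼ'`
  pointwise and maps `ν (x, w)` to `ν (x, w')` with `‖w' - e₀‖ = ‖w - e₀‖`; and **after the
  isotopy the band leaves `Kⱼ'` radially**: for every `y ∈ [h₁, h₂]` the normal derivative of the
  moved band `H 1 ∘ band` at the edge point `(1, y)` is `-c • e₀` with `c > 0`.

## References

* R. C. Kirby, *The Topology of 4-Manifolds*, LNM 1374, Springer (1989), Ch. I §4. [Kirby1989]
* M. W. Hirsch, *Differential Topology*, GTM 33 (1976), Ch. 8 §1, Thm. 1.3. [HirschDT1976]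
-/

open scoped Manifold ContDiff Topology
open Function Set Metric

noncomputable section

namespace Literature.Topology.FourManifolds

namespace BandCore

variable [Knot.TubularNbhd.SmoothnessFacts] {A Kj : Knot} (ν : Knot.TubularNbhd Kj)
  {avoid : Set (Metric.sphere (0 : EuclideanSpace ℝ (Fin 4)) 1)} (b : BandCore A ν.pushOff avoid)

omit [Knot.TubularNbhd.SmoothnessFacts] in
/-- A radial cut-off profile: smooth, `= 1` at `0`, `= 0` beyond `τ²`. [folklore] -/
theorem cutoffProfile_props {τ : ℝ} (hτ : 0 < τ) :
    ContDiff ℝ ∞ (fun s : ℝ ↦ Real.smoothTransition ((τ ^ 2 - s) / (τ ^ 2 / 2))) ∧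
      Real.smoothTransition ((τ ^ 2 - 0) / (τ ^ 2 / 2)) = 1 ∧
      ∀ s, τ ^ 2 ≤ s → Real.smoothTransition ((τ ^ 2 - s) / (τ ^ 2 / 2)) = 0 := by
  refine ⟨Real.smoothTransition.contDiff.comp ((contDiff_const.sub contDiff_id).div_const _), ?_, fun s hs ↦ ?_⟩
  · apply Real.smoothTransition.one_of_one_le
    rw [sub_zero, le_div_iff₀ (by positivity)]; nlinarith
  · apply Real.smoothTransition.zero_of_nonpos
    exact div_nonpos_of_nonpos_of_nonneg (by linarith) (by positivity)

omit [Knot.TubularNbhd.SmoothnessFacts] in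
/-- **Product rule at a zero**: if `g x₀ = 0` then `x ↦ f x • g x` has derivative `f x₀ • g'` at
`x₀` (the term with `f'` drops out). [folklore] -/
theorem hasFDerivAt_smul_of_eq_zero {E F : Type*} [NormedAddCommGroup E] [NormedSpace ℝ E]
    [NormedAddCommGroup F] [NormedSpace ℝ F] {f : E → ℝ} {g : E → F} {x₀ : E} {f' : E →L[ℝ] ℝ}
    {g' : E →L[ℝ] F} (hf : HasFDerivAt f f' x₀) (hg : HasFDerivAt g g' x₀) (h0 : g x₀ = 0) :
    HasFDerivAt (fun x ↦ f x • g x) (f x₀ • g') x₀ := by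
  have h := hf.smul hg
  rw [h0, ContinuousLinearMap.smulRight_zero, add_zero] at h
  exact h

/-- **Step A of the normalisation of the band end.** See the module docstring.
[cite: Kirby1989, Ch. I §4] -/
theorem exists_stepA {h₁ h₂ : ℝ} (hh₁ : 10⁻¹ < h₁) (hh : h₁ ≤ h₂) (hh₂ : h₂ < 9 / 10) {τ : ℝ} (hτ : 0 < τ) :
    ∃ H : AmbientIsotopy (𝓡 3) (Metric.sphere (0 : EuclideanSpace ℝ (Fin 4)) 1),
      (∀ t z, z ∉ range ⇑ν → H.toFun t z = z) ∧
      (∀ t (x : Metric.sphere (0 : EuclideanSpace ℝ (Fin 2)) 1) (w : EuclideanSpace ℝ (Fin 2)),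
        τ ≤ ‖w - framingBaseVector‖ → H.toFun t (ν (x, w)) = ν (x, w)) ∧
      (∀ t (x : Metric.sphere (0 : EuclideanSpace ℝ (Fin 2)) 1) (w : EuclideanSpace ℝ (Fin 2)),
        (∀ s ∈ Ioo (b.thetaB (9 / 10)) (b.thetaB 10⁻¹), x ≠ circlePt s) → H.toFun t (ν (x, w)) = ν (x, w)) ∧
      (∀ t ∈ Icc (0 : ℝ) 1, ∀ x : Metric.sphere (0 : EuclideanSpace ℝ (Fin 2)) 1,
        H.toFun t (ν.pushOff x) = ν.pushOff x) ∧
      (∀ t ∈ Icc (0 : ℝ) 1, ∀ (x : Metric.sphere (0 : EuclideanSpace ℝ (Fin 2)) 1) (w : EuclideanSpace ℝ (Fin 2)),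
        ∃ w' : EuclideanSpace ℝ (Fin 2), H.toFun t (ν (x, w)) = ν (x, w') ∧
          ‖w' - framingBaseVector‖ = ‖w - framingBaseVector‖) ∧
      ∀ y ∈ Icc h₁ h₂, ∃ c : ℝ, 0 < c ∧
        fderiv ℝ (fun x ↦ (ν.toTubeNbhd.toHomeo.symm (H.toFun 1 (b.band x))).2) (pt2 1 y) (pt2 1 0) =
          (-c) • framingBaseVector := by
  haveI := fact_finrank_euclideanSpace_succ 1
  -- the angle data and the rotation tube isotopy
  obtain ⟨β, M, hβ, hM, hβI, hβsupp, hrot⟩ := b.exists_rotationAngleFun ν hh₁ hh hh₂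
  obtain ⟨hφs, hφ1, hφ0⟩ := cutoffProfile_props hτ
  set φ : ℝ → ℝ := fun s ↦ Real.smoothTransition ((τ ^ 2 - s) / (τ ^ 2 / 2)) with hφ
  set E : EuclideanSpace ℝ (Fin 2) := framingBaseVector with hE
  obtain ⟨Θ, -, hΘ, hΘfix⟩ :=
    SlideSweep.exists_tubeIsotopy_rotationAboutPushOff E norm_framingBaseVector M hβ hτ hφs hφ0
  -- push forward along `ν`
  set νf : Unit → TubeNbhd (𝓡 3) ⇑Kj := fun _ ↦ ν.toTubeNbhd with hνf
  have hdisj : Pairwise fun i j : Unit ↦ Disjoint (range (νf i).toFun) (range (νf j).toFun) :=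
    Subsingleton.pairwise
  set H := TubeNbhd.tubeIsotopyPush νf hdisj (fun _ ↦ Θ) with hH
  have hHν : ∀ t q, H.toFun t (ν q) = ν (Θ.toFun t q) := fun t q ↦ by
    have h := TubeNbhd.tubeIsotopyPush_apply_toFun (ν := νf) hdisj (fun _ ↦ Θ) t () q
    simpa [hνf] using h
  have hHout : ∀ t z, z ∉ range ⇑ν → H.toFun t z = z := fun t z hz ↦
    TubeNbhd.tubeIsotopyPush_apply_of_forall_not_mem hdisj (fun _ ↦ Θ) t (fun _ ↦ by simpa [hνf] using hz)
  -- the formula of `Θ` for `t ∈ [0, 1]` (then `t β x ∈ [0, 1]`)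
  have htβ : ∀ t ∈ Icc (0 : ℝ) 1, ∀ x, t * β x ∈ Icc (0 : ℝ) 1 := fun t ht x ↦
    ⟨mul_nonneg ht.1 (hβI x).1, mul_le_one₀ ht.2 (hβI x).1 (hβI x).2⟩
  refine ⟨H, hHout, fun t x w hw ↦ ?_, fun t x w hx ↦ ?_, fun t ht x ↦ ?_, fun t ht x w ↦ ?_, fun y hy ↦ ?_⟩
  · rw [hHν, hΘfix t x w hw]
  · -- not over the window: `β x = 0`, the rotation angle vanishes
    have hβx : β x = 0 := by
      by_contra h
      obtain ⟨s, hs, rfl⟩ := hβsupp x h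
      exact hx s hs rfl
    rw [hHν, hΘ t x w (by rw [hβx, mul_zero]; exact ⟨le_rfl, zero_le_one⟩)]
    simp [hβx]
  · -- the push-off `ν (x, e₀)` is fixed: `w - E = 0`
    rw [Knot.TubularNbhd.pushOff_apply, hHν, hΘ t x _ (htβ t ht x)]
    simp [hE]
  · refine ⟨(Θ.toFun t (x, w)).2, ?_, ?_⟩
    · rw [hHν, hΘ t x w (htβ t ht x)]
    · rw [hΘ t x w (htβ t ht x)]
      set θ := t * β x * M * φ (‖w - E‖ ^ 2) with hθ
      have hre : E + Real.cos θ • (w - E) + Real.sin θ •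
          ((-((w - E) 1)) • EuclideanSpace.single (0 : Fin 2) (1 : ℝ) + ((w - E) 0) • EuclideanSpace.single 1 1) - E =
          Real.cos θ • (w - E) + Real.sin θ •
          ((-((w - E) 1)) • EuclideanSpace.single (0 : Fin 2) (1 : ℝ) + ((w - E) 0) • EuclideanSpace.single 1 1) := by
        abel
      rw [hre]
      exact SlideSweep.norm_rotate θ (w - E)
  · -- the derivative clause
    have hyI : y ∈ Ioo (10⁻¹ : ℝ) (9 / 10) := ⟨by linarith [hy.1], by linarith [hy.2]⟩
    have hyc : y ∈ Icc (10⁻¹ : ℝ) (9 / 10) := Ioo_subset_Icc_self hyI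
    set xs : EuclideanSpace ℝ (Fin 2) := pt2 1 y with hxs
    set W : EuclideanSpace ℝ (Fin 2) → EuclideanSpace ℝ (Fin 2) :=
      fun x ↦ (ν.toTubeNbhd.toHomeo.symm (b.band x)).2 with hW
    set U : EuclideanSpace ℝ (Fin 2) → Metric.sphere (0 : EuclideanSpace ℝ (Fin 2)) 1 :=
      fun x ↦ (ν.toTubeNbhd.toHomeo.symm (b.band x)).1 with hU
    set O : Set (EuclideanSpace ℝ (Fin 2)) := b.band ⁻¹' range ⇑ν with hO
    have hOo : IsOpen O := b.isOpen_preimage_range_tube ν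
    have hxsO : xs ∈ O := b.band_pt2_one_mem_range ν hyc
    have hOn : O ∈ 𝓝 xs := hOo.mem_nhds hxsO
    have hWs : ContDiffAt ℝ ∞ W xs := (b.contDiffOn_tubeNormal' ν).contDiffAt hOn
    have hW_xs : W xs = E := b.tubeNormal_band_pt2_one ν hyc
    have hU_xs : U xs = circlePt (b.thetaB y) := b.tubeBase_band_pt2_one ν hyc
    -- `β ∘ U` is smooth near `xs`
    have hβU : ContDiffAt ℝ ∞ (fun x ↦ β (U x)) xs := by
      have h1 : ContMDiffOn 𝓘(ℝ, EuclideanSpace ℝ (Fin 2)) (𝓡 1) ∞ U O :=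
        contMDiff_fst.comp_contMDiffOn (b.contMDiffOn_tubeCoord ν)
      have h2 : ContMDiffOn 𝓘(ℝ, EuclideanSpace ℝ (Fin 2)) 𝓘(ℝ, ℝ) ∞ (fun x ↦ β (U x)) O :=
        hβ.comp_contMDiffOn h1
      exact (contMDiffOn_iff_contDiffOn.1 h2).contDiffAt hOn
    -- the angle function and the local formula for the new normal coordinate
    set ang : EuclideanSpace ℝ (Fin 2) → ℝ := fun x ↦ 1 * β (U x) * M * φ (‖W x - E‖ ^ 2) with hang
    have hangs : ContDiffAt ℝ ∞ ang xs := by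
      have h3 : ContDiffAt ℝ ∞ (fun x ↦ φ (‖W x - E‖ ^ 2)) xs :=
        hφs.contDiffAt.comp xs ((contDiff_norm_sq ℝ).contDiffAt.comp xs (hWs.sub contDiffAt_const))
      exact ((contDiffAt_const.mul hβU).mul contDiffAt_const).mul h3
    have hang_xs : ang xs = M * β (circlePt (b.thetaB y)) := by
      simp only [hang, hW_xs, sub_self, norm_zero, hU_xs]
      rw [zero_pow two_ne_zero]
      have : φ 0 = 1 := hφ1
      rw [this]; ring
    have hloc : ∀ x ∈ O, (ν.toTubeNbhd.toHomeo.symm (H.toFun 1 (b.band x))).2 =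
        E + Real.cos (ang x) • (W x - E) + Real.sin (ang x) •
          ((-((W x - E) 1)) • EuclideanSpace.single (0 : Fin 2) (1 : ℝ) + ((W x - E) 0) • EuclideanSpace.single 1 1) := by
      intro x hx
      have hq : b.band x = ν (ν.toTubeNbhd.toHomeo.symm (b.band x)) := by
        have htgt : b.band x ∈ ν.toTubeNbhd.toHomeo.target := by
          rw [TubeNbhd.toHomeo_target]
          obtain ⟨q, hq⟩ := (show b.band x ∈ range ⇑ν from hx)
          exact ⟨q, by rw [Knot.TubularNbhd.toTubeNbhd_toFun]; exact hq⟩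
        have h := ν.toTubeNbhd.toHomeo.right_inv htgt
        rw [TubeNbhd.toHomeo_apply, Knot.TubularNbhd.toTubeNbhd_toFun] at h
        exact h.symm
      rw [hq, hHν]
      have hback : ν.toTubeNbhd.toHomeo.symm (ν (Θ.toFun 1 (ν.toTubeNbhd.toHomeo.symm (b.band x)))) =
          Θ.toFun 1 (ν.toTubeNbhd.toHomeo.symm (b.band x)) := by
        have := ν.toTubeNbhd.toHomeo_symm_apply (Θ.toFun 1 (ν.toTubeNbhd.toHomeo.symm (b.band x)))
        simpa using this
      rw [hback]
      have hpair : ν.toTubeNbhd.toHomeo.symm (b.band x) = (U x, W x) := Prod.ext rfl rfl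
      rw [hpair, hΘ 1 (U x) (W x) (htβ 1 ⟨zero_le_one, le_rfl⟩ (U x))]
    -- derivative of the local formula at `xs`
    have hWd : HasFDerivAt W (fderiv ℝ W xs) xs := (hWs.differentiableAt (by simp)).hasFDerivAt
    have hWE : HasFDerivAt (fun x ↦ W x - E) (fderiv ℝ W xs) xs := hWd.sub_const E
    have hWE0 : W xs - E = 0 := by rw [hW_xs, sub_self]
    set Jl : EuclideanSpace ℝ (Fin 2) →L[ℝ] EuclideanSpace ℝ (Fin 2) :=
      (-(EuclideanSpace.proj (1 : Fin 2))).smulRight (EuclideanSpace.single (0 : Fin 2) (1 : ℝ)) +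
        (EuclideanSpace.proj (0 : Fin 2)).smulRight (EuclideanSpace.single (1 : Fin 2) (1 : ℝ)) with hJl
    have hJl_apply : ∀ v : EuclideanSpace ℝ (Fin 2),
        Jl v = (-(v 1)) • EuclideanSpace.single (0 : Fin 2) (1 : ℝ) + (v 0) • EuclideanSpace.single 1 1 := by
      intro v; simp [hJl]
    have hJWE : HasFDerivAt (fun x ↦ (-((W x - E) 1)) • EuclideanSpace.single (0 : Fin 2) (1 : ℝ) +
        ((W x - E) 0) • EuclideanSpace.single 1 1) (Jl.comp (fderiv ℝ W xs)) xs := by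
      have h := Jl.hasFDerivAt.comp xs hWE
      refine h.congr_of_eventuallyEq (Filter.Eventually.of_forall fun x ↦ ?_)
      simp only [comp_apply, hJl_apply]
    have hJWE0 : (-((W xs - E) 1)) • EuclideanSpace.single (0 : Fin 2) (1 : ℝ) +
        ((W xs - E) 0) • EuclideanSpace.single 1 1 = 0 := by
      rw [hWE0]; simp
    have hcosd : HasFDerivAt (fun x ↦ Real.cos (ang x)) (fderiv ℝ (fun x ↦ Real.cos (ang x)) xs) xs :=
      ((Real.contDiff_cos.contDiffAt.comp xs hangs).differentiableAt (by simp)).hasFDerivAt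
    have hsind : HasFDerivAt (fun x ↦ Real.sin (ang x)) (fderiv ℝ (fun x ↦ Real.sin (ang x)) xs) xs :=
      ((Real.contDiff_sin.contDiffAt.comp xs hangs).differentiableAt (by simp)).hasFDerivAt
    have hG : HasFDerivAt (fun x ↦ E + Real.cos (ang x) • (W x - E) + Real.sin (ang x) •
        ((-((W x - E) 1)) • EuclideanSpace.single (0 : Fin 2) (1 : ℝ) + ((W x - E) 0) • EuclideanSpace.single 1 1))
        (Real.cos (ang xs) • fderiv ℝ W xs + Real.sin (ang xs) • (Jl.comp (fderiv ℝ W xs))) xs := by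
      have h1 := hasFDerivAt_smul_of_eq_zero hcosd hWE hWE0
      have h2 := hasFDerivAt_smul_of_eq_zero hsind hJWE hJWE0
      have := ((hasFDerivAt_const E xs).add h1).add h2
      rw [zero_add] at this
      exact this
    -- the new normal coordinate agrees with the local formula near `xs`
    have hev : (fun x ↦ (ν.toTubeNbhd.toHomeo.symm (H.toFun 1 (b.band x))).2) =ᶠ[𝓝 xs]
        fun x ↦ E + Real.cos (ang x) • (W x - E) + Real.sin (ang x) •
          ((-((W x - E) 1)) • EuclideanSpace.single (0 : Fin 2) (1 : ℝ) + ((W x - E) 0) • EuclideanSpace.single 1 1) := by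
      filter_upwards [hOn] with x hx
      exact hloc x hx
    have hnew : HasFDerivAt (fun x ↦ (ν.toTubeNbhd.toHomeo.symm (H.toFun 1 (b.band x))).2)
        (Real.cos (ang xs) • fderiv ℝ W xs + Real.sin (ang xs) • (Jl.comp (fderiv ℝ W xs))) xs :=
      hG.congr_of_eventuallyEq hev
    refine ⟨2 * ‖fderiv ℝ W xs (pt2 1 0)‖, ?_, ?_⟩
    · have := b.fderiv_tubeNormal_ne_zero ν hyI
      have : 0 < ‖fderiv ℝ W xs (pt2 1 0)‖ := norm_pos_iff.2 this
      linarith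
    · rw [hnew.fderiv]
      simp only [add_apply, FunLike.coe_smul, Pi.smul_apply,
        ContinuousLinearMap.comp_apply, hJl_apply, hang_xs]
      exact hrot y hy

end BandCore

end Literature.Topology.FourManifolds
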